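import Summits.BirchSwinnertonDyer.Rank1Residual.X9.IwasawaLowerBound
import Literature.NumberTheory.EllipticCurves.Miller2011.JetchevBoundIrreducible
import HarnessLib

/-!
# Class X9, analytic rank 0: the Iwasawa lower bound against Miller's Thm. 5.4 (Jetchev–Cha) upper
# bound — the Tamagawa-obstructed SHA row (cell `b2b-bsdres`, unit `b2b-bsdres-x9`, gen 9)

HONEST FRAMING (run/shared/lean/b2b/bsd-rank1-residual/, verbatim in every file): the goal of the
cell is to DELETE the COMBINATION-SHAPED residual classes of the Birch–Swinnerton-Dyer formula for
ALL analytic-rank `≤ 1` elliptic curves over `ℚ` — "full BSD formula for every rank `≤ 1` curve in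
class `C`" assembled STRICTLY from published theorems — so that the rank-`≤ 1` remainder becomes
exactly the CONSTRUCTION-SHAPED classes, which are TYPED (missing-input `Prop`s), NOT attempted.
This is not "finishing BSD". Theorems only; no named fact; X9 stays typed; no pair is booked here.

Companion of `X9/IwasawaLowerBound.lean` (LOWER half `ord_p #Ш_an ≤ ord_p #Ш` in rank 0 from BCS
2025 Thm. 1.1.2 (a) + Greenberg Thm. 4.1 + the period unit + modularity + GZK and ONE certificate
`μ(𝓛_p(E)) = 0`).  Here the UPPER half is Miller 2011 Thm. 5.4 under Cha's hypotheses (Jetchev's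
sharpening: `ord_p #Ш(E/ℚ) ≤ 2·(ord_p [E(K) : ℤ y_K] − ord_p c_q)` for a prime `q ∣ N`; named fact
`Miller2011.thm54_cha_padicValNat_shaOrder_add_tamagawa_le`, FLAG `Miller11-Thm54-Cha-case`, as in
the gen-7 file `Theorems/Rank1ResidualX9JetchevCha.lean`), so that a pair whose Heegner index is
inflated by a Tamagawa number divisible by `p` is reached: census row `199988e1 @ 5`
(`#Ш_an = 25`, `ord_5 [E(K):ℤy_K] = 2` at `D = −47`, `c_173 = 5`: `k = 1`, `q = 173`), whose lower
half `Ш(E)[5] ≠ 0` had no instrument in gen 7/8 (no visible partner of rank 2) and is now the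
two-engine certificate `μ(𝓛_5(E)) = 0` (HOME/b2b-bsdres-x9/g9/mu/MU-CERTS.md).

References: Miller 2011 Thm. 5.4 / Def. 1.1; BCS 2025 Thm. 1.1.2 (a); Greenberg LNM 1716 Thm. 4.1.
-/

set_option autoImplicit false

noncomputable section

open scoped Classical MatrixGroups ModularForm

open CongruenceSubgroup WeierstrassCurve Literature.NumberTheory.EllipticCurves
  Literature.NumberTheory.EllipticCurves.ModularForms Literature.NumberTheory.EllipticCurves.Rank1Residual
  Literature.NumberTheory.EllipticCurves.Miller2011

namespace Summit.BirchSwinnertonDyer.Rank1Residual.X9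

variable (W : WeierstrassCurve ℚ) [W.IsElliptic] [W.IsGloballyMinimal] (p : ℕ) [Fact p.Prime]
  {N : ℕ} [NeZero N] {K : Type} [Field K] [NumberField K]

/-- **Rank 0, `ord_p #Ш_an = 2k`, index inflated by ONE Tamagawa number: `BSD(E,p)` from Miller's
Thm. 5.4 (UPPER) and the Iwasawa lower bound (LOWER).**  Non-CM `E`, `p ≥ 5` good ordinary, `E[p]`
irreducible, `r_an = 0`; Heegner field `K` (`p ∤ d_K`, `p² ∤ N`) and point `P` of infinite order; a
prime `q ∣ N` with `ord_p [E(K) : ℤ P] ≤ k + ord_p c_q(E)`; `#Ш_an = s` with `2k ≤ ord_p s`; and the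
certificate `μ(𝓛_p(E)) = 0` (`hcert`).  Binders: `hMJ` (Miller 2011 Thm. 5.4, FLAG
`Miller11-Thm54-Cha-case`), `hBCS`, `hGr`, `h5`, `hmodP`, `hmodL`, `hGZK` (all published).  With
`ord_p c_q = 0` this is `bsdp_of_cha_of_unitCoeff_of_analyticRank_eq_zero` again.
[cite: Miller2011LMS, Thm. 5.4 and Def. 1.1] [cite: BurungaleCastellaSkinner2025, Thm. 1.1.2 (a) (p. 2 of arXiv:2405.00270v2)] -/
theorem bsdp_of_millerJetchev_of_unitCoeff_of_analyticRank_eq_zero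
    (hMJ : thm54_cha_padicValNat_shaOrder_add_tamagawa_le)
    (hBCS : burungale_castella_skinner_charIdeal_eq_padicLFunction)
    (hGr : greenberg_charValue_rankZero) (h5 : realPeriodRat_eq_unit_mul_plusPeriod)
    (hmodP : nonempty_modularParametrizationData) (hmodL : hasEntireLFunction_rat)
    (hGZK : rank_eq_analyticRank_of_analyticRank_le_one)
    (hcm : ¬ W.HasCM) (hp : 5 ≤ p) (hord : GoodOrd W p) (hirr : Irr W p) (hr : W.analyticRank = 0)
    (hK : IsImaginaryQuadratic K) (hH : SatisfiesHeegnerHypothesis N K)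
    {P : (W.baseChange K).toAffine.Point} (hP : IsHeegnerPoint N W K P) (hnt : ¬ IsOfFinAddOrder P)
    (q : ℕ) [Fact q.Prime] (hqN : q ∣ N)
    (hpD : ¬ (p : ℤ) ∣ NumberField.discr K) (hpN : ¬ p ^ 2 ∣ N) {k : ℕ}
    (hI : padicValNat p (AddSubgroup.zmultiples P).index ≤
      k + padicValNat p ((W.baseChange ℚ_[q]).localTamagawaNumber ℤ_[q]))
    {s : ℚ} (hs : shaAn W = (s : ℂ)) (hv : (2 * k : ℤ) ≤ padicValRat p s)
    (hcert : ∀ [NeZero (W.conductorNorm ℤ)] (f : CuspForm (Gamma0 (W.conductorNorm ℤ)) 2),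
        IsNewformOf W f → ∀ (ϖ : ℚ), (ϖ : ℝ) * W.realPeriodRat = plusPeriod f →
      ∃ n : ℕ, ‖PowerSeries.coeff n
        (PowerSeries.C (ϖ : ℚ_[p]) * padicLFunction f (unitRoot W p : ℚ_[p]))‖ = 1) :
    BSDp W p := by
  have hp2 : p ≠ 2 := by omega
  have hr1 : W.analyticRank ≤ 1 := by omega
  have hup : padicValNat p W.shaOrder ≤ 2 * (k + padicValNat p
      ((W.baseChange ℚ_[q]).localTamagawaNumber ℤ_[q]) -
      padicValNat p ((W.baseChange ℚ_[q]).localTamagawaNumber ℤ_[q])) :=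
    padicValNat_shaOrder_le_of_index_sub_tamagawa hMJ W hK hH hP hnt p q hqN hcm hp2 hpD hpN hirr
      hr1 hI le_rfl
  have hup' : padicValNat p W.shaOrder ≤ 2 * k := by omega
  have hU : Typed.MissingUpperBoundAt W p := by
    refine ⟨s, hs, le_trans ?_ hv⟩
    exact_mod_cast hup'
  exact Typed.bsdp_of_missingPPartAt W p hGZK hr1
    (Typed.missingPPartAt_of_lower_of_upper W p
      (missingLowerBoundAt_of_unitCoeff_of_analyticRank_eq_zero W p hBCS hGr h5 hmodP hmodL hGZK hp
        hord hirr hr hcert) hU)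

/-- **Class X9 version** (non-CM, `p ≥ 5` good ordinary, `E[p]` irreducible AUTOMATIC).  Census
instance of this shape: `199988e1 @ 5` (`k = 1`, `q = 173`). Per pair; not a class theorem.
[cite: Miller2011LMS, Thm. 5.4 and Def. 1.1] -/
theorem bsdp_of_classX9_of_millerJetchev_of_unitCoeff
    (hMJ : thm54_cha_padicValNat_shaOrder_add_tamagawa_le)
    (hBCS : burungale_castella_skinner_charIdeal_eq_padicLFunction)
    (hGr : greenberg_charValue_rankZero) (h5 : realPeriodRat_eq_unit_mul_plusPeriod)
    (hmodP : nonempty_modularParametrizationData) (hmodL : hasEntireLFunction_rat)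
    (hGZK : rank_eq_analyticRank_of_analyticRank_le_one)
    (hX9 : ClassX9 W p) (hr : W.analyticRank = 0)
    (hK : IsImaginaryQuadratic K) (hH : SatisfiesHeegnerHypothesis N K)
    {P : (W.baseChange K).toAffine.Point} (hP : IsHeegnerPoint N W K P) (hnt : ¬ IsOfFinAddOrder P)
    (q : ℕ) [Fact q.Prime] (hqN : q ∣ N)
    (hpD : ¬ (p : ℤ) ∣ NumberField.discr K) (hpN : ¬ p ^ 2 ∣ N) {k : ℕ}
    (hI : padicValNat p (AddSubgroup.zmultiples P).index ≤
      k + padicValNat p ((W.baseChange ℚ_[q]).localTamagawaNumber ℤ_[q]))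
    {s : ℚ} (hs : shaAn W = (s : ℂ)) (hv : (2 * k : ℤ) ≤ padicValRat p s)
    (hcert : ∀ [NeZero (W.conductorNorm ℤ)] (f : CuspForm (Gamma0 (W.conductorNorm ℤ)) 2),
        IsNewformOf W f → ∀ (ϖ : ℚ), (ϖ : ℝ) * W.realPeriodRat = plusPeriod f →
      ∃ n : ℕ, ‖PowerSeries.coeff n
        (PowerSeries.C (ϖ : ℚ_[p]) * padicLFunction f (unitRoot W p : ℚ_[p]))‖ = 1) :
    BSDp W p :=
  bsdp_of_millerJetchev_of_unitCoeff_of_analyticRank_eq_zero W p hMJ hBCS hGr h5 hmodP hmodL hGZK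
    hX9.1 hX9.2.2.1 hX9.2.1 hX9.2.2.2.1 hr hK hH hP hnt q hqN hpD hpN hI hs hv hcert

omit [NeZero N] [Field K] [NumberField K] in
/-- **The rank-0 X9 residue is EXACTLY the Euler-system half** (appended, gen 9).  On class X9 with
`r_an = 0`, granted the published binders (BCS 2025 Thm. 1.1.2 (a), Greenberg Thm. 4.1, the period
unit, modularity, GZK) and the finite certificate `μ(𝓛_p(E)) = 0`:
`BSDp W p ↔ Typed.MissingUpperBoundAt W p` (`ord_p #Ш(E) ≤ ord_p #Ш(E)_an`).  `←`:
`missingInputAt_of_missingUpperBoundAt_of_unitCoeff`; `→`: Miller's `BSDp` gives the whole `p`-part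
(`Typed.missingPPartAt_of_bsdp`).  So every future UPPER-bound instrument at a non-surjective good
ordinary prime (Heegner index, descent, an Euler-system bound without big image) closes the pair.
[cite: Miller2011LMS, Def. 1.1] -/
theorem bsdp_iff_missingUpperBoundAt_of_classX9_of_unitCoeff
    (hBCS : burungale_castella_skinner_charIdeal_eq_padicLFunction)
    (hGr : greenberg_charValue_rankZero) (h5 : realPeriodRat_eq_unit_mul_plusPeriod)
    (hmodP : nonempty_modularParametrizationData) (hmodL : hasEntireLFunction_rat)
    (hGZK : rank_eq_analyticRank_of_analyticRank_le_one)
    (hX9 : ClassX9 W p) (hr : W.analyticRank = 0)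
    (hcert : ∀ [NeZero (W.conductorNorm ℤ)] (f : CuspForm (Gamma0 (W.conductorNorm ℤ)) 2),
        IsNewformOf W f → ∀ (ϖ : ℚ), (ϖ : ℝ) * W.realPeriodRat = plusPeriod f →
      ∃ n : ℕ, ‖PowerSeries.coeff n
        (PowerSeries.C (ϖ : ℚ_[p]) * padicLFunction f (unitRoot W p : ℚ_[p]))‖ = 1) :
    BSDp W p ↔ Typed.MissingUpperBoundAt W p := by
  have hr1 : W.analyticRank ≤ 1 := by omega
  haveI : Finite W.sha := (hGZK W hr1).2
  constructor
  · intro h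
    exact (Typed.lower_and_upper_of_missingPPartAt W p (Typed.missingPPartAt_of_bsdp W p h)).2
  · intro hup
    exact Typed.bsdp_of_missingPPartAt W p hGZK hr1
      (missingInputAt_of_missingUpperBoundAt_of_unitCoeff W p hBCS hGr h5 hmodP hmodL hGZK hX9 hr hup
        hcert)

end Summit.BirchSwinnertonDyer.Rank1Residual.X9
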